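import Summits.BirchSwinnertonDyer.BirchSwinnertonDyer.Theses.KolyvaginRankRigidityAtTwo
import Literature.NumberTheory.EllipticCurves.HeegnerPointsOfConductorOneGaloisConjProofs
import HarnessLib

/-!
# LINE skeleton for crux V2 `KolyvaginCorankRigidityAtTwo` (stmt-BirchSwinnertonDyer-23949),
# route `KolyvaginRankRigidityAtTwo` — line `kolyvagin-depth-split`

V2 is Kolyvagin's 1991 structure theorem (Math. Ann. 291, Thm. 4; W. Zhang 2014, Thm. 11.2 (i))
AT `p = 2`, read on `ℤ₂`-coranks: at a non-zero Heegner-point Kolyvagin class `c_M(n) ≠ 0` of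
MINIMAL depth `ν = #(ℓ ∣ n)`, `max(c, c') = ν + 1` and `min(c, c') ≤ ν`, where
`c = corank Sel_{2^∞}(E/ℚ)`, `c' = corank Sel_{2^∞}(E^{(d_K)}/ℚ)`.

The line splits V2 along the printed architecture of Kolyvagin's proof:

* `stub_depthZero` — **`ν = 0` (PROVED here, modulo the route's printed inputs)**: `c_M(1) ≠ 0`
  forces `P(1) = y_K` non-torsion (Gross 1991 Prop. 4.7 (1)), hence `ord_{s=1} L(E/K, s) = 1`
  (Gross–Zagier, the route's support conjunct `analyticRankEK_eq_one_iff_heegner_nonTorsion`),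
  hence `{ord L(E), ord L(E^{(d_K)})} = {0, 1}` (`analyticRankEK_eq_add_of`, entire `L`), hence by
  Gross–Zagier–Kolyvagin over `ℚ` (`rank_eq_analyticRank_of_analyticRank_le_one`, the route item
  `MultPublishedInputsAtTwo`) the coranks are `(1, 0)` or `(0, 1)` — Kolyvagin 1990 Thm. A at
  every prime including `2`.
* `stub_upperBoundPosDepth` — **Kolyvagin's DESCENT at `2`** (UPPER bound, depth `ν ≥ 1`, no
  minimality): a non-zero class `c_M(n) ≠ 0` at depth `ν` bounds BOTH coranks,
  `(c ≤ ν + 1 ∧ c' ≤ ν) ∨ (c' ≤ ν + 1 ∧ c ≤ ν)` (Kolyvagin 1991 Thm. 2–3 / McCallum 1991 §5 for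
  `ℓ` odd; at `2` the Čebotarev step must be run one level up — Kolyvagin's `ℓ = 2` device,
  Euler systems 1990 Thm. B₂ — and the `τ`-eigenspace bookkeeping replaced by the `E`/`E^{(d_K)}`
  split of coranks, `selmerCorank_baseChange_quadratic_holds`; the planner memo
  `MEMO-chebotarev-at-two.md` on the crux item records the two bounded defects).
* `stub_lowerBoundMinimalPosDepth` — **the triangular basis at `2`** (LOWER bound at MINIMAL
  depth `ν ≥ 1`): all classes of depth `< ν` vanish, so the depth-`ν` classes are Selmer classes
  and `ν + 1` of them are independent modulo `2^M` for all large `M`: `ν + 1 ≤ c ∨ ν + 1 ≤ c'`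
  (W. Zhang 2014 Lemma 8.4 (1)–(2) / Kolyvagin 1991 Thm. 4, `p` odd; at `2` up to bounded index).

Glue `KolyvaginCorankRigidityAtTwo_of`: `ν = 0` is the first stub; for `ν ≥ 1` the two bounds
combine by `omega`. The glue takes the route's support items `PrintedInputsRankOneAtTwo` and
`MultPublishedInputsAtTwo` BY NAME (both already hypotheses of the route's `closes`), so the
eventual closure of V2 along this line is modulo those printed inputs (D-0014 twin shape).

HONEST FRAMING: stubs 2 and 3 are the beyond-print content (Kolyvagin's induction at the prime
`2`); nothing here proves BSD, and V2 itself is not proved by this file while they are `sorry`.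
-/

set_option autoImplicit false
-- the Theorems namespace of this sub repeats the summit name by design (D-0017 nested layout)
set_option linter.dupNamespace false

noncomputable section

open scoped Classical

open WeierstrassCurve Literature.NumberTheory.EllipticCurves
  Literature.NumberTheory.EllipticCurves.ModularForms
open Summit.BirchSwinnertonDyer.BirchSwinnertonDyer.Theses.KolyvaginRankRigidityAtTwo

namespace Summit.BirchSwinnertonDyer.BirchSwinnertonDyer.Theorems.KolyvaginRankRigidity

/-! ## Stub 1 — depth zero (Kolyvagin–Gross–Zagier at `2`, modulo the printed inputs) -/

/-- **Depth `ν = 0` of V2, modulo the route's printed inputs.** For `W/ℚ` globally minimal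
elliptic, `K` imaginary quadratic with the Heegner hypothesis for `N_E`, granted Gross–Zagier in
the form `ord_{s=1} L(E/K,s) = 1 ↔ y_K` non-torsion for `(W, N_E, K)`, the entire continuation of
`L(E,s)` (for `ord L(E/K) = ord L(E) + ord L(E^{(d_K)})`) and Gross–Zagier–Kolyvagin over `ℚ`
(`rank = ord ≤ 1`, `Ш` finite): if a conductor-`1` Kolyvagin class `c_M(n) ≠ 0` with
`#(ℓ ∣ n) = 0` (so `n = 1`) is non-zero, then `(c, c') ∈ {(1,0), (0,1)}` in V2's currency.
[cite: GrossLMS1991, Prop. 4.7 (1) and §4 (P_1 = y_K)] [cite: Kolyvagin1990, Thm. A] -/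
theorem stub_depthZero :
    ∀ (W : WeierstrassCurve ℚ) [W.IsElliptic] [W.IsGloballyMinimal] (K : Type) [Field K]
      [NumberField K], IsImaginaryQuadratic K → ∀ [NeZero (W.conductorNorm ℤ)],
      SatisfiesHeegnerHypothesis (W.conductorNorm ℤ) K →
      analyticRankEK_eq_one_iff_heegner_nonTorsion W (W.conductorNorm ℤ) K →
      WeierstrassCurve.hasEntireLFunction_rat →
      rank_eq_analyticRank_of_analyticRank_le_one →
      ∀ (Dt : ModularParametrizationData W (W.conductorNorm ℤ)) (β : ℤ) (ι : K →+* ℂ) (n : ℕ)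
        (d : KolyvaginHeegnerData Dt β ι n) (M : ℕ),
        KolyvaginDescent.KolSupp (Zhang2014.IsKolyvaginPrime (W.conductorNorm ℤ) W K 2) n →
        d.kolyvaginClass Nat.prime_two M ≠ 0 → n.primeFactors.card = 0 →
        ((W.selmerCorank 2 = n.primeFactors.card + 1 ∧
            (W.quadraticTwist (NumberField.discr K : ℚ)).selmerCorank 2 ≤ n.primeFactors.card) ∨
          ((W.quadraticTwist (NumberField.discr K : ℚ)).selmerCorank 2 = n.primeFactors.card + 1 ∧
            W.selmerCorank 2 ≤ n.primeFactors.card)) := by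
  sorry

/-! ## Stub 2 — Kolyvagin's descent at `2` (upper bound at positive depth) -/

/-- **UPPER bound at depth `ν ≥ 1` (Kolyvagin's descent at `2`).** On V2's habitat (non-CM,
good-ordinary-or-multiplicative at `2`, surjective 2-adic image; `K` imaginary quadratic,
`d_K ≠ −3, −4` odd, Heegner hypothesis), a non-zero class `c_M(n) ≠ 0` (`n` Kolyvagin-square-free
at `2`, `1 ≤ M ≤ M(n)`, depth `ν = #(ℓ ∣ n) ≥ 1`, NO minimality) bounds both coranks:
`(c ≤ ν + 1 ∧ c' ≤ ν) ∨ (c' ≤ ν + 1 ∧ c ≤ ν)`. Printed for `ℓ` odd in `B(E)` (Kolyvagin 1991,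
Thm. 2–3; McCallum 1991 §5); at `2` it is the research content of this line (Čebotarev one level
up, bounded inflation/bottom-bit defects, coranks via `E`/`E^{(d_K)}` instead of `τ`-eigenspaces).
[cite: Kolyvagin1991MathAnn, §2 Thm. 2–4] [cite: McCallumLMS1991, §5] -/
theorem stub_upperBoundPosDepth :
    ∀ (W : WeierstrassCurve ℚ) [W.IsElliptic] [W.IsGloballyMinimal], ¬ W.HasCM →
      (Rank1Residual.GoodOrd W 2 ∨ Rank1Residual.Mult W 2) →
      (∀ m : ℕ, W.HasSurjectiveModNGaloisRep (2 ^ m : ℕ)) →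
      ∀ (K : Type) [Field K] [NumberField K], IsImaginaryQuadratic K → NumberField.discr K ≠ -3 →
      NumberField.discr K ≠ -4 → ¬ ((2 : ℤ) ∣ NumberField.discr K) → ∀ [NeZero (W.conductorNorm ℤ)],
      SatisfiesHeegnerHypothesis (W.conductorNorm ℤ) K →
      ∀ (Dt : ModularParametrizationData W (W.conductorNorm ℤ)) (β : ℤ) (ι : K →+* ℂ) (n : ℕ)
        (d : KolyvaginHeegnerData Dt β ι n) (M : ℕ),
        KolyvaginDescent.KolSupp (Zhang2014.IsKolyvaginPrime (W.conductorNorm ℤ) W K 2) n →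
        1 ≤ M → (M : ℕ∞) ≤ Zhang2014.levelIndex W 2 n → d.kolyvaginClass Nat.prime_two M ≠ 0 →
        1 ≤ n.primeFactors.card →
        ((W.selmerCorank 2 ≤ n.primeFactors.card + 1 ∧
            (W.quadraticTwist (NumberField.discr K : ℚ)).selmerCorank 2 ≤ n.primeFactors.card) ∨
          ((W.quadraticTwist (NumberField.discr K : ℚ)).selmerCorank 2 ≤ n.primeFactors.card + 1 ∧
            W.selmerCorank 2 ≤ n.primeFactors.card)) := by
  sorry

/-! ## Stub 3 — the triangular basis at `2` (lower bound at minimal positive depth) -/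

/-- **LOWER bound at MINIMAL depth `ν ≥ 1` (Kolyvagin classes below the vanishing order are
independent Selmer classes).** Same habitat; at a non-zero class `c_M(n) ≠ 0` whose depth
`ν = #(ℓ ∣ n) ≥ 1` is minimal among all non-zero classes of the system (all `c_{M'}(n')` with
fewer prime factors vanish), one of the two coranks is at least `ν + 1`:
`ν + 1 ≤ c ∨ ν + 1 ≤ c'`. Printed for `p` odd as W. Zhang 2014, Lemma 8.4 (1)–(2) (the
`(ν+1) × (ν+1)` upper-triangular localisation matrix) / Kolyvagin 1991 Thm. 4; at `2` modulo
`2^M` for all large `M`, up to the bounded defects, hence on coranks.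
[cite: WZhang2014, Lemma 8.4 and Thm. 11.2 (i)] [cite: Kolyvagin1991MathAnn, §2 Thm. 4] -/
theorem stub_lowerBoundMinimalPosDepth :
    ∀ (W : WeierstrassCurve ℚ) [W.IsElliptic] [W.IsGloballyMinimal], ¬ W.HasCM →
      (Rank1Residual.GoodOrd W 2 ∨ Rank1Residual.Mult W 2) →
      (∀ m : ℕ, W.HasSurjectiveModNGaloisRep (2 ^ m : ℕ)) →
      ∀ (K : Type) [Field K] [NumberField K], IsImaginaryQuadratic K → NumberField.discr K ≠ -3 →
      NumberField.discr K ≠ -4 → ¬ ((2 : ℤ) ∣ NumberField.discr K) → ∀ [NeZero (W.conductorNorm ℤ)],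
      SatisfiesHeegnerHypothesis (W.conductorNorm ℤ) K →
      ∀ (Dt : ModularParametrizationData W (W.conductorNorm ℤ)) (β : ℤ) (ι : K →+* ℂ) (n : ℕ)
        (d : KolyvaginHeegnerData Dt β ι n) (M : ℕ),
        KolyvaginDescent.KolSupp (Zhang2014.IsKolyvaginPrime (W.conductorNorm ℤ) W K 2) n →
        1 ≤ M → (M : ℕ∞) ≤ Zhang2014.levelIndex W 2 n → d.kolyvaginClass Nat.prime_two M ≠ 0 →
        (∀ (n' : ℕ) (d' : KolyvaginHeegnerData Dt β ι n') (M' : ℕ),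
          KolyvaginDescent.KolSupp (Zhang2014.IsKolyvaginPrime (W.conductorNorm ℤ) W K 2) n' →
          1 ≤ M' → (M' : ℕ∞) ≤ Zhang2014.levelIndex W 2 n' → d'.kolyvaginClass Nat.prime_two M' ≠ 0 →
          n.primeFactors.card ≤ n'.primeFactors.card) →
        1 ≤ n.primeFactors.card →
        (n.primeFactors.card + 1 ≤ W.selmerCorank 2 ∨
          n.primeFactors.card + 1 ≤ (W.quadraticTwist (NumberField.discr K : ℚ)).selmerCorank 2) := by
  sorry

/-! ## Glue -/

/-- **V2 from the three stubs, modulo the route's printed inputs `PrintedInputsRankOneAtTwo`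
(Gross–Zagier iff, entire `L`) and `MultPublishedInputsAtTwo` (Gross–Zagier–Kolyvagin over `ℚ`),
taken BY NAME** (both are hypotheses of the route's deciding theorem `closes` already): depth
`0` is `stub_depthZero`; at depth `ν ≥ 1` the upper bound `stub_upperBoundPosDepth` and the lower
bound `stub_lowerBoundMinimalPosDepth` leave exactly V2's dichotomy (`omega`). -/
theorem KolyvaginCorankRigidityAtTwo_of (hIn : PrintedInputsRankOneAtTwo)
    (hGZK : MultPublishedInputsAtTwo) : KolyvaginCorankRigidityAtTwo := by
  intro W _ _ hCM hred hsur K _ _ hK hne3 hne4 h2d _ hHN Dt β ι n d M hn hM1 hMle hne hmin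
  obtain ⟨-, -, -, -, hE, hGZ, -⟩ := hIn
  have hGZK' : rank_eq_analyticRank_of_analyticRank_le_one := hGZK
  rcases Nat.eq_zero_or_pos n.primeFactors.card with h0 | hpos
  · exact stub_depthZero W K hK hHN (hGZ W _ K) hE hGZK' Dt β ι n d M hn hne h0
  · have hub := stub_upperBoundPosDepth W hCM hred hsur K hK hne3 hne4 h2d hHN Dt β ι n d M hn hM1
      hMle hne hpos
    have hlb := stub_lowerBoundMinimalPosDepth W hCM hred hsur K hK hne3 hne4 h2d hHN Dt β ι n d M
      hn hM1 hMle hne hmin hpos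
    omega

end Summit.BirchSwinnertonDyer.BirchSwinnertonDyer.Theorems.KolyvaginRankRigidity
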